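import Summits.ValiantsHypothesis.ValiantsHypothesis.Theorems.FeketeSOSFeketeSOSHardPaleyRIPBoxFejer
import Mathlib.Algebra.Polynomial.Degree.Defs
import Mathlib.Data.Nat.Log
import Mathlib.Tactic.IntervalCases

/-!
# Route FeketeSOS — crux `FeketeSOSHard` (stmt-ValiantsHypothesis-3996), line `paley-rip` v3,
# `stub_tameOperator` piece (B): flat patterns on an interval are cheap — `μ_{[0,k)}(𝟙_{[0,2k−1)}) ≤ ⌊log₂ k⌋ + 5/2`

In the vocabulary of `stub_tameOperator` (`Cruxes/FeketeSOSHard/Lines/paley_rip_v3.lean`): a family of weighted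
squares `(c_j, w_j)` with `supp w_j ⊆ [0,k)`, pattern `Σ_j c_j w_j²` and archimedean mass `Σ_j sqMass c_j w_j =
Σ_j |c_j|·‖w_j‖₂²`.  From the dyadic Fejér identities of `…PaleyRIPBoxFejer.lean`:

* `flat_rep_dyadic`  — `k = 2^J`: the all-ones pattern `Σ_{n<2k−1} X^n` has such a family of mass `≤ J + 1`;
* `flat_rep_general` — `k = N + 3·2^J`: mass `≤ J + 3 + N/2^{J+1}`;
* `flat_rep`         — every `k ≥ 1`: mass `≤ Nat.log 2 k + 5/2`.

So the "R_k lemma" of the census (B) holds in the sharper form `O(log k)` (and `Ω(log k)` is forced by Hilbert's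
inequality, see the module docstring of `…PaleyRIPBoxFejer.lean`).  Twisting `X ↦ uX` (`|u| = 1`) transports the
same families to every exponential pattern `Σ_{n<2k−1} u^n X^n` at the same mass, whence
`μ_H(g) ≤ (‖ĝ‖₁/N)(⌊log₂ k⌋ + 5/2)` for any pattern `g` on `H + H` by superposition — the input the census's
"R-trick" needs for narrow-band blocks (sequel file).  Tools landed here for reuse: coefficients / supports /
masses of shifted boxes and of two nested boxes, and the closure of "representable with supports in `[0,k)` and
mass `≤ m`" under sums (`rep_single`, `rep_congr`, `rep_add`, `rep_sum`).

Honest framing (rung currency): a Theorems-side helper `--supports` stmt-3996; nothing here closes a registered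
stub; `stub_tameOperator` (r ≥ 2), `stub_paleyFlatRIP` and the crux stay OPEN; `VP ≠ VNP` is untouched.
-/

set_option linter.dupNamespace false

namespace Summit.ValiantsHypothesis.ValiantsHypothesis.Theorems.FeketeSOSHardPaleyRIP

open Polynomial Finset
open scoped BigOperators

noncomputable section

/-! ## Coefficients, supports and masses of (shifted) boxes -/

/-- Coefficients of a shifted box: `[X^n](X^t B_L) = 𝟙[t ≤ n < t + L]`. [folklore] -/
theorem coeff_X_pow_mul_box (t L n : ℕ) :
    (X ^ t * ∑ i ∈ range L, (X : ℂ[X]) ^ i).coeff n = if t ≤ n ∧ n < t + L then 1 else 0 := by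
  rw [coeff_X_pow_mul', finsetSum_coeff]
  simp only [coeff_X_pow]
  by_cases ht : t ≤ n
  · rw [if_pos ht, Finset.sum_ite_eq (range L) (n - t)]
    by_cases hn : n < t + L
    · rw [if_pos (mem_range.2 (by omega)), if_pos ⟨ht, hn⟩]
    · rw [if_neg (fun h => hn (by have := mem_range.1 h; omega)), if_neg (fun h => hn h.2)]
  · rw [if_neg ht, if_neg (fun h => ht h.1)]

/-- A shifted box `X^t B_L` with `t + L ≤ k` is supported in `[0, k)`. [folklore] -/
theorem support_X_pow_mul_box (t L k : ℕ) (h : t + L ≤ k) :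
    (X ^ t * ∑ i ∈ range L, (X : ℂ[X]) ^ i).support ⊆ range k := by
  intro n hn
  rw [mem_support_iff, coeff_X_pow_mul_box] at hn
  rw [mem_range]
  by_contra hk
  exact hn (if_neg fun h' => hk (by omega))

/-- Counting an interval inside `[0,k)`: `Σ_{n<k} 𝟙[t ≤ n < t+L] = L` when `t + L ≤ k`. [folklore] -/
theorem sum_indicator_interval (t L k : ℕ) (h : t + L ≤ k) :
    (∑ n ∈ range k, (if t ≤ n ∧ n < t + L then (1 : ℝ) else 0)) = L := by
  rw [Finset.sum_boole]
  have : (range k).filter (fun n => t ≤ n ∧ n < t + L) = Finset.Ico t (t + L) := by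
    ext n
    simp only [Finset.mem_filter, mem_range, Finset.mem_Ico]
    omega
  rw [this, Nat.card_Ico, Nat.add_sub_cancel_left]

/-- The mass sum of `sqMass` may be taken over any superset of the support. [folklore] -/
theorem sqMass_eq_of_support_subset (c : ℂ) (w : ℂ[X]) (T : Finset ℕ) (hw : w.support ⊆ T) :
    sqMass c w = ‖c‖ * ∑ a ∈ T, ‖w.coeff a‖ ^ 2 := by
  unfold sqMass
  congr 1
  refine Finset.sum_subset hw fun a _ ha => ?_
  rw [notMem_support_iff.1 ha, norm_zero]
  ring

/-- **Mass of a shifted box**: `sqMass c (X^t B_L) = |c| · L`. [folklore] -/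
theorem sqMass_X_pow_mul_box (c : ℂ) (t L k : ℕ) (h : t + L ≤ k) :
    sqMass c (X ^ t * ∑ i ∈ range L, (X : ℂ[X]) ^ i) = ‖c‖ * L := by
  rw [sqMass_eq_of_support_subset c _ (range k) (support_X_pow_mul_box t L k h)]
  congr 1
  rw [← sum_indicator_interval t L k h]
  refine Finset.sum_congr rfl fun n _ => ?_
  rw [coeff_X_pow_mul_box]
  split_ifs <;> simp

/-- A sum of two NESTED shifted boxes `X^t B_L + X^{t'} B_M` (`[t, t+L) ⊆ [t', t'+M) ⊆ [0, k)`) is supported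
in `[0,k)`. [folklore] -/
theorem support_two_boxes (t L t' M k : ℕ) (h2 : t + L ≤ t' + M) (h3 : t' + M ≤ k) :
    (X ^ t * (∑ i ∈ range L, (X : ℂ[X]) ^ i) + X ^ t' * ∑ i ∈ range M, (X : ℂ[X]) ^ i).support ⊆
      range k := by
  intro n hn
  rw [mem_support_iff, coeff_add, coeff_X_pow_mul_box, coeff_X_pow_mul_box] at hn
  rw [mem_range]
  by_contra hk
  refine hn ?_
  rw [if_neg fun h' => hk (by omega), if_neg fun h' => hk (by omega), add_zero]

/-- **Mass of two nested boxes**: `sqMass c (X^t B_L + X^{t'} B_M) = |c| · (3L + M)` when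
`[t, t+L) ⊆ [t', t'+M)` (coefficient `2` on the inner interval, `1` on the rest). [folklore] -/
theorem sqMass_two_boxes (c : ℂ) (t L t' M k : ℕ) (h1 : t' ≤ t) (h2 : t + L ≤ t' + M) (h3 : t' + M ≤ k) :
    sqMass c (X ^ t * (∑ i ∈ range L, (X : ℂ[X]) ^ i) + X ^ t' * ∑ i ∈ range M, (X : ℂ[X]) ^ i) =
      ‖c‖ * (3 * L + M) := by
  rw [sqMass_eq_of_support_subset c _ (range k) (support_two_boxes t L t' M k h2 h3)]
  congr 1
  have hL := sum_indicator_interval t L k (by omega)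
  have hM := sum_indicator_interval t' M k h3
  have key : ∀ n ∈ range k,
      ‖(X ^ t * (∑ i ∈ range L, (X : ℂ[X]) ^ i) + X ^ t' * ∑ i ∈ range M, (X : ℂ[X]) ^ i).coeff n‖ ^ 2 =
        3 * (if t ≤ n ∧ n < t + L then (1 : ℝ) else 0) + (if t' ≤ n ∧ n < t' + M then (1 : ℝ) else 0) := by
    intro n _
    rw [coeff_add, coeff_X_pow_mul_box, coeff_X_pow_mul_box]
    by_cases hin : t ≤ n ∧ n < t + L
    · have hout : t' ≤ n ∧ n < t' + M := by omega
      rw [if_pos hin, if_pos hout, if_pos hin, if_pos hout]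
      norm_num
    · rw [if_neg hin, if_neg hin, zero_add]
      split_ifs <;> norm_num
  rw [Finset.sum_congr rfl key, Finset.sum_add_distrib, ← Finset.mul_sum, hL, hM]

/-! ## Combining representations by weighted squares with supports inside a fixed finite set `T` -/

/-- One weighted square is a representation of itself. [folklore] -/
theorem rep_single (T : Finset ℕ) (c : ℂ) (w : ℂ[X]) (hw : w.support ⊆ T) {m : ℝ} (hm : sqMass c w ≤ m) :
    ∃ (s : ℕ) (c' : Fin s → ℂ) (w' : Fin s → ℂ[X]), (∀ j, (w' j).support ⊆ T) ∧
      (∑ j, C (c' j) * w' j ^ 2) = C c * w ^ 2 ∧ (∑ j, sqMass (c' j) (w' j)) ≤ m :=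
  ⟨1, fun _ => c, fun _ => w, fun _ => hw, by simp, by simpa using hm⟩

/-- Transport of a representation along an equality of patterns and a weakening of the mass bound. [folklore] -/
theorem rep_congr {T : Finset ℕ} {F G : ℂ[X]} {m m' : ℝ} (hFG : F = G) (hm : m ≤ m')
    (h : ∃ (s : ℕ) (c : Fin s → ℂ) (w : Fin s → ℂ[X]), (∀ j, (w j).support ⊆ T) ∧
      (∑ j, C (c j) * w j ^ 2) = F ∧ (∑ j, sqMass (c j) (w j)) ≤ m) :
    ∃ (s : ℕ) (c : Fin s → ℂ) (w : Fin s → ℂ[X]), (∀ j, (w j).support ⊆ T) ∧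
      (∑ j, C (c j) * w j ^ 2) = G ∧ (∑ j, sqMass (c j) (w j)) ≤ m' := by
  obtain ⟨s, c, w, h1, h2, h3⟩ := h
  exact ⟨s, c, w, h1, h2.trans hFG, h3.trans hm⟩

/-- Representations add (concatenate the families; masses add). [folklore] -/
theorem rep_add {T : Finset ℕ} {F G : ℂ[X]} {m m' : ℝ}
    (hF : ∃ (s : ℕ) (c : Fin s → ℂ) (w : Fin s → ℂ[X]), (∀ j, (w j).support ⊆ T) ∧
      (∑ j, C (c j) * w j ^ 2) = F ∧ (∑ j, sqMass (c j) (w j)) ≤ m)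
    (hG : ∃ (s : ℕ) (c : Fin s → ℂ) (w : Fin s → ℂ[X]), (∀ j, (w j).support ⊆ T) ∧
      (∑ j, C (c j) * w j ^ 2) = G ∧ (∑ j, sqMass (c j) (w j)) ≤ m') :
    ∃ (s : ℕ) (c : Fin s → ℂ) (w : Fin s → ℂ[X]), (∀ j, (w j).support ⊆ T) ∧
      (∑ j, C (c j) * w j ^ 2) = F + G ∧ (∑ j, sqMass (c j) (w j)) ≤ m + m' := by
  obtain ⟨s, c, w, h1, h2, h3⟩ := hF
  obtain ⟨s', c', w', h1', h2', h3'⟩ := hG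
  refine ⟨s + s', Fin.append c c', Fin.append w w', ?_, ?_, ?_⟩
  · intro j
    induction j using Fin.addCases with
    | left i => simpa using h1 i
    | right i => simpa using h1' i
  · rw [Fin.sum_univ_add]
    simp only [Fin.append_left, Fin.append_right, h2, h2']
  · rw [Fin.sum_univ_add]
    simp only [Fin.append_left, Fin.append_right]
    exact add_le_add h3 h3'

/-- Representations of the terms of a finite sum combine to one of the sum. [folklore] -/
theorem rep_sum {ι : Type*} (I : Finset ι) (T : Finset ℕ) (F : ι → ℂ[X]) (m : ι → ℝ)
    (h : ∀ i ∈ I, ∃ (s : ℕ) (c : Fin s → ℂ) (w : Fin s → ℂ[X]), (∀ j, (w j).support ⊆ T) ∧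
      (∑ j, C (c j) * w j ^ 2) = F i ∧ (∑ j, sqMass (c j) (w j)) ≤ m i) :
    ∃ (s : ℕ) (c : Fin s → ℂ) (w : Fin s → ℂ[X]), (∀ j, (w j).support ⊆ T) ∧
      (∑ j, C (c j) * w j ^ 2) = ∑ i ∈ I, F i ∧ (∑ j, sqMass (c j) (w j)) ≤ ∑ i ∈ I, m i := by
  classical
  induction I using Finset.induction_on with
  | empty => exact ⟨0, fun _ => 0, fun _ => 0, fun j => Fin.elim0 j, by simp, by simp⟩
  | insert a I ha ih =>
    rw [Finset.sum_insert ha, Finset.sum_insert ha]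
    exact rep_add (h a (Finset.mem_insert_self a I))
      (ih fun i hi => h i (Finset.mem_insert_of_mem hi))

/-! ## Flat interval patterns are cheap -/

/-- **Flat interval pattern, dyadic length: mass `log₂ k + 1`.**  For `k = 2^J` the all-ones pattern
`Σ_{n<2k−1} X^n` is a combination of `2J+1` weighted squares of boxes supported in `[0,k)` of total
archimedean mass `J + 1` (`flat_dyadic_identity`; all weights positive). [folklore] -/
theorem flat_rep_dyadic (J : ℕ) :
    ∃ (s : ℕ) (c : Fin s → ℂ) (w : Fin s → ℂ[X]), (∀ j, (w j).support ⊆ range (2 ^ J)) ∧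
      (∑ j, C (c j) * w j ^ 2) = ∑ n ∈ range (2 * 2 ^ J - 1), (X : ℂ[X]) ^ n ∧
      (∑ j, sqMass (c j) (w j)) ≤ (J : ℝ) + 1 := by
  have hnorm : ∀ i : ℕ, ‖(((2 ^ (i + 1) : ℕ) : ℂ)⁻¹)‖ * ((2 ^ i : ℕ) : ℝ) = 1 / 2 := by
    intro i
    rw [norm_inv, Complex.norm_natCast]
    push_cast
    rw [pow_succ]
    field_simp
  have hK : ‖(((2 ^ J : ℕ) : ℂ)⁻¹)‖ * ((2 ^ J : ℕ) : ℝ) = 1 := by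
    rw [norm_inv, Complex.norm_natCast]
    have : ((2 ^ J : ℕ) : ℝ) ≠ 0 := by positivity
    field_simp
  -- the central Fejér square `K⁻¹ B_K²`
  have h0 : ∃ (s : ℕ) (c : Fin s → ℂ) (w : Fin s → ℂ[X]), (∀ j, (w j).support ⊆ range (2 ^ J)) ∧
      (∑ j, C (c j) * w j ^ 2) =
        C (((2 ^ J : ℕ) : ℂ)⁻¹) * (∑ i ∈ range (2 ^ J), (X : ℂ[X]) ^ i) ^ 2 ∧
      (∑ j, sqMass (c j) (w j)) ≤ 1 := by
    refine rep_congr (by rw [pow_zero, one_mul]) le_rfl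
      (rep_single (range (2 ^ J)) _ (X ^ 0 * ∑ i ∈ range (2 ^ J), (X : ℂ[X]) ^ i)
        (support_X_pow_mul_box 0 _ _ (by omega)) (le_of_eq ?_))
    rw [sqMass_X_pow_mul_box _ 0 _ (2 ^ J) (by omega), hK]
  -- the dyadic squares at both ends, mass `1/2 + 1/2` per scale
  have h1 : ∃ (s : ℕ) (c : Fin s → ℂ) (w : Fin s → ℂ[X]), (∀ j, (w j).support ⊆ range (2 ^ J)) ∧
      (∑ j, C (c j) * w j ^ 2) =
        ∑ j ∈ range J, C (((2 ^ (j + 1) : ℕ) : ℂ)⁻¹) *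
          ((∑ i ∈ range (2 ^ j), (X : ℂ[X]) ^ i) ^ 2 +
            (X ^ (2 ^ J - 2 ^ j) * ∑ i ∈ range (2 ^ j), (X : ℂ[X]) ^ i) ^ 2) ∧
      (∑ j, sqMass (c j) (w j)) ≤ ∑ j ∈ range J, (1 : ℝ) := by
    refine rep_sum (range J) (range (2 ^ J))
      (fun j => C (((2 ^ (j + 1) : ℕ) : ℂ)⁻¹) *
          ((∑ i ∈ range (2 ^ j), (X : ℂ[X]) ^ i) ^ 2 +
            (X ^ (2 ^ J - 2 ^ j) * ∑ i ∈ range (2 ^ j), (X : ℂ[X]) ^ i) ^ 2))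
      (fun _ => (1 : ℝ)) fun j hj => ?_
    have hj' : 2 ^ j ≤ 2 ^ J := Nat.pow_le_pow_right two_pos (mem_range.1 hj).le
    have ha := rep_single (range (2 ^ J)) (((2 ^ (j + 1) : ℕ) : ℂ)⁻¹) (X ^ 0 * ∑ i ∈ range (2 ^ j), (X : ℂ[X]) ^ i)
      (support_X_pow_mul_box 0 _ _ (by omega)) (m := 1 / 2)
      (le_of_eq (by rw [sqMass_X_pow_mul_box _ 0 _ (2 ^ J) (by omega), hnorm]))
    have hb := rep_single (range (2 ^ J)) (((2 ^ (j + 1) : ℕ) : ℂ)⁻¹)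
      (X ^ (2 ^ J - 2 ^ j) * ∑ i ∈ range (2 ^ j), (X : ℂ[X]) ^ i)
      (support_X_pow_mul_box _ _ _ (by omega)) (m := 1 / 2)
      (le_of_eq (by rw [sqMass_X_pow_mul_box _ _ _ (2 ^ J) (by omega), hnorm]))
    refine rep_congr ?_ (by norm_num) (rep_add ha hb)
    rw [pow_zero, one_mul, mul_add]
  refine rep_congr (flat_dyadic_identity J) ?_ (rep_add h0 h1)
  simp [add_comm]

/-- **Flat interval pattern, general length `k = N + 3·2^J`: mass `J + 3 + N/2^{J+1}`.**
(`flat_general_identity`: `2J+2` dyadic Fejér squares and two polarised trapezoids, all supported in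
`[0,k)`.) [folklore] -/
theorem flat_rep_general (J N : ℕ) :
    ∃ (s : ℕ) (c : Fin s → ℂ) (w : Fin s → ℂ[X]), (∀ j, (w j).support ⊆ range (N + 3 * 2 ^ J)) ∧
      (∑ j, C (c j) * w j ^ 2) = ∑ n ∈ range (2 * (N + 3 * 2 ^ J) - 1), (X : ℂ[X]) ^ n ∧
      (∑ j, sqMass (c j) (w j)) ≤ (J : ℝ) + 3 + (N : ℝ) / 2 ^ (J + 1) := by
  have hnorm : ∀ i : ℕ, ‖(((2 ^ (i + 1) : ℕ) : ℂ)⁻¹)‖ * ((2 ^ i : ℕ) : ℝ) = 1 / 2 := by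
    intro i
    rw [norm_inv, Complex.norm_natCast]
    push_cast
    rw [pow_succ]
    field_simp
  have h2J : 2 ^ (J + 1) = 2 * 2 ^ J := by rw [pow_succ]; ring
  -- the dyadic squares at both ends
  have h1 : ∃ (s : ℕ) (c : Fin s → ℂ) (w : Fin s → ℂ[X]), (∀ j, (w j).support ⊆ range (N + 3 * 2 ^ J)) ∧
      (∑ j, C (c j) * w j ^ 2) =
        ∑ j ∈ range (J + 1), C (((2 ^ (j + 1) : ℕ) : ℂ)⁻¹) *
          ((∑ i ∈ range (2 ^ j), (X : ℂ[X]) ^ i) ^ 2 +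
            (X ^ (N + 2 ^ J + (2 ^ (J + 1) - 2 ^ j)) * ∑ i ∈ range (2 ^ j), (X : ℂ[X]) ^ i) ^ 2) ∧
      (∑ j, sqMass (c j) (w j)) ≤ ∑ j ∈ range (J + 1), (1 : ℝ) := by
    refine rep_sum (range (J + 1)) (range (N + 3 * 2 ^ J))
      (fun j => C (((2 ^ (j + 1) : ℕ) : ℂ)⁻¹) *
          ((∑ i ∈ range (2 ^ j), (X : ℂ[X]) ^ i) ^ 2 +
            (X ^ (N + 2 ^ J + (2 ^ (J + 1) - 2 ^ j)) * ∑ i ∈ range (2 ^ j), (X : ℂ[X]) ^ i) ^ 2))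
      (fun _ => (1 : ℝ)) fun j hj => ?_
    have hj' : 2 ^ j ≤ 2 ^ J := Nat.pow_le_pow_right two_pos (by have := mem_range.1 hj; omega)
    have ha := rep_single (range (N + 3 * 2 ^ J)) (((2 ^ (j + 1) : ℕ) : ℂ)⁻¹)
      (X ^ 0 * ∑ i ∈ range (2 ^ j), (X : ℂ[X]) ^ i)
      (support_X_pow_mul_box 0 _ _ (by omega)) (m := 1 / 2)
      (le_of_eq (by rw [sqMass_X_pow_mul_box _ 0 _ (N + 3 * 2 ^ J) (by omega), hnorm]))
    have hb := rep_single (range (N + 3 * 2 ^ J)) (((2 ^ (j + 1) : ℕ) : ℂ)⁻¹)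
      (X ^ (N + 2 ^ J + (2 ^ (J + 1) - 2 ^ j)) * ∑ i ∈ range (2 ^ j), (X : ℂ[X]) ^ i)
      (support_X_pow_mul_box _ _ _ (by omega)) (m := 1 / 2)
      (le_of_eq (by rw [sqMass_X_pow_mul_box _ _ _ (N + 3 * 2 ^ J) (by omega), hnorm]))
    refine rep_congr ?_ (by norm_num) (rep_add ha hb)
    rw [pow_zero, one_mul, mul_add]
  -- the two polarised trapezoids
  set q : ℂ := (4 * ((2 ^ (J + 1) : ℕ) : ℂ))⁻¹ with hqdef
  have hqn : ‖q‖ = (4 * (2 : ℝ) ^ (J + 1))⁻¹ := by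
    rw [hqdef, norm_inv, norm_mul, Complex.norm_natCast]
    simp
  have hqn' : ‖-q‖ = (4 * (2 : ℝ) ^ (J + 1))⁻¹ := by rw [norm_neg, hqn]
  have hZ1 := rep_single (range (N + 3 * 2 ^ J)) q
    (X ^ 0 * (∑ i ∈ range (2 ^ (J + 1)), (X : ℂ[X]) ^ i) + X ^ 0 * ∑ i ∈ range (2 ^ (J + 1) + N), (X : ℂ[X]) ^ i)
    (support_two_boxes 0 _ 0 _ _ (by omega) (by omega))
    (le_of_eq (sqMass_two_boxes q 0 _ 0 _ (N + 3 * 2 ^ J) le_rfl (by omega) (by omega)))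
  have hZ2 := rep_single (range (N + 3 * 2 ^ J)) (-q) (X ^ (2 ^ (J + 1)) * ∑ i ∈ range N, (X : ℂ[X]) ^ i)
    (support_X_pow_mul_box _ _ _ (by omega))
    (le_of_eq (sqMass_X_pow_mul_box (-q) _ _ (N + 3 * 2 ^ J) (by omega)))
  have hZ3 := rep_single (range (N + 3 * 2 ^ J)) q
    (X ^ (N + 2 ^ J) * (∑ i ∈ range (2 ^ (J + 1)), (X : ℂ[X]) ^ i) +
      X ^ (2 ^ J) * ∑ i ∈ range (2 ^ (J + 1) + N), (X : ℂ[X]) ^ i)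
    (support_two_boxes _ _ _ _ _ (by omega) (by omega))
    (le_of_eq (sqMass_two_boxes q _ _ _ _ (N + 3 * 2 ^ J) (by omega) (by omega) (by omega)))
  have hZ4 := rep_single (range (N + 3 * 2 ^ J)) (-q) (X ^ (2 ^ J) * ∑ i ∈ range N, (X : ℂ[X]) ^ i)
    (support_X_pow_mul_box _ _ _ (by omega))
    (le_of_eq (sqMass_X_pow_mul_box (-q) _ _ (N + 3 * 2 ^ J) (by omega)))
  refine rep_congr ?_ ?_ (rep_add h1 (rep_add (rep_add hZ1 hZ2) (rep_add hZ3 hZ4)))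
  · rw [← flat_general_identity J N, C_neg, pow_zero, one_mul, one_mul]
    ring
  · rw [Finset.sum_const, Finset.card_range, hqn, hqn']
    push_cast
    have h2 : (0 : ℝ) < 2 ^ (J + 1) := by positivity
    field_simp
    ring_nf
    nlinarith [h2]

/-- **Flat interval patterns are cheap (all lengths): mass `≤ ⌊log₂ k⌋ + 5/2`.**  For every `k ≥ 1` the
all-ones pattern `Σ_{n<2k−1} X^n` on `[0, 2k−1)` is `Σ_j c_j w_j²` with every `w_j` supported in `[0, k)` and
`Σ_j |c_j|·‖w_j‖₂² ≤ Nat.log 2 k + 5/2`.  (The dual weight `z = 1/r_{[0,k)}` and Hilbert's inequality give the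
matching lower bound `(ln k)/π − O(1)` for every such representation, so `Θ(log k)` is the truth; the
nuclear-norm bound `‖(1/r_H(h+h'))‖_* = O(log² k)` via two triangularly truncated Hilbert matrices, assumed in
`Cruxes/FeketeSOSHard/Lines/paley-rip-stub3-census.md` §5–§6 (B), is superseded by this explicit identity.)
[folklore] -/
theorem flat_rep (k : ℕ) (hk : 1 ≤ k) :
    ∃ (s : ℕ) (c : Fin s → ℂ) (w : Fin s → ℂ[X]), (∀ j, (w j).support ⊆ range k) ∧
      (∑ j, C (c j) * w j ^ 2) = ∑ n ∈ range (2 * k - 1), (X : ℂ[X]) ^ n ∧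
      (∑ j, sqMass (c j) (w j)) ≤ (Nat.log 2 k : ℝ) + 5 / 2 := by
  have hlog0 : (0 : ℝ) ≤ (Nat.log 2 k : ℝ) := Nat.cast_nonneg _
  by_cases hk3 : k < 3
  · interval_cases k
    · refine rep_congr rfl (by linarith) (flat_rep_dyadic 0)
    · refine rep_congr rfl (by push_cast; linarith) (flat_rep_dyadic 1)
  · rw [not_lt] at hk3
    obtain ⟨J, hJ1, hJ2⟩ : ∃ J : ℕ, 3 * 2 ^ J ≤ k ∧ k < 6 * 2 ^ J := by
      refine ⟨Nat.log 2 (k / 3), ?_, ?_⟩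
      · have h := Nat.pow_log_le_self 2 (x := k / 3) (by omega)
        omega
      · have h := Nat.lt_pow_succ_log_self (b := 2) one_lt_two (k / 3)
        rw [Nat.pow_succ] at h
        omega
    obtain ⟨N, rfl⟩ : ∃ N : ℕ, k = N + 3 * 2 ^ J := ⟨k - 3 * 2 ^ J, by omega⟩
    refine rep_congr rfl ?_ (flat_rep_general J N)
    have h2 : (0 : ℝ) < 2 ^ (J + 1) := by positivity
    have hN3 : (N : ℝ) / 2 ^ (J + 1) ≤ 3 / 2 := by
      rw [div_le_iff₀ h2]
      have : (N : ℝ) * 2 ≤ 3 * 2 ^ (J + 1) := by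
        rw [pow_succ]; exact_mod_cast (show N * 2 ≤ 3 * (2 ^ J * 2) by omega)
      linarith
    by_cases hN : N < 2 ^ J
    · have hN1 : (N : ℝ) / 2 ^ (J + 1) ≤ 1 / 2 := by
        rw [div_le_iff₀ h2]
        have : (N : ℝ) * 2 ≤ 2 ^ (J + 1) := by
          rw [pow_succ]; exact_mod_cast (show N * 2 ≤ 2 ^ J * 2 by omega)
        linarith
      have hlog : J + 1 ≤ Nat.log 2 (N + 3 * 2 ^ J) :=
        Nat.le_log_of_pow_le one_lt_two (by rw [pow_succ]; omega)
      have hlog' : (J : ℝ) + 1 ≤ (Nat.log 2 (N + 3 * 2 ^ J) : ℝ) := by exact_mod_cast hlog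
      linarith
    · have hlog : J + 2 ≤ Nat.log 2 (N + 3 * 2 ^ J) :=
        Nat.le_log_of_pow_le one_lt_two (by rw [pow_succ, pow_succ]; omega)
      have hlog' : (J : ℝ) + 2 ≤ (Nat.log 2 (N + 3 * 2 ^ J) : ℝ) := by exact_mod_cast hlog
      linarith

end

end Summit.ValiantsHypothesis.ValiantsHypothesis.Theorems.FeketeSOSHardPaleyRIP
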